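import Literature.Topology.FourManifolds.RegularLevelSplitting
import Literature.Topology.FourManifolds.SPC4HandleChainProofs
import Literature.Topology.CompactHull
import Mathlib.Geometry.Manifold.PartitionOfUnity
import HarnessLib

/-!
# The compact hull of a regular sublevel set is a regular sublevel set
# (Phillips 1967, proof of Lemma 1.1: the manifolds `Mᵢ'`)

Topic `Literature/Topology/FourManifolds`; infrastructure for the handle decomposition of open
manifolds (Phillips 1967, Lemma 1.1, consumer: the named fact
`Literature.Topology.Immersions.Phillips1967_exists_isLocalDiffeomorph_of_isParallelizable`).
Everything here is **proved**; no definitions, no named facts.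

Phillips (proof of Lemma 1.1, p. 176): *"First realize `M` as `⋃ Mᵢ`, an expanding union of
compact manifolds with smooth boundary, such that `Mᵢ ⊂ Int Mᵢ₊₁`. Next let `Mᵢ'` be the
union of `Mᵢ` and of the compact components of `M - Int Mᵢ`. Then `M = ⋃ Mᵢ'` is again an
expanding union of compact manifolds with boundary, and `Mᵢ' ⊂ Int Mᵢ₊₁'`."*  With
`Mᵢ = {f ≤ cᵢ}` a regular sublevel set of a proper Morse function (the tree's
`exists_isMorse_tendsto_cocompact_atTop`, `exists_strictMono_regularLevel_of_isMorse`,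
`ProperMorseFunction.lean`) and `Mᵢ' = compactHull Mᵢ` (`Literature.Topology.compactHull`,
`CompactHull.lean`), this file supplies the words *"compact manifolds with (smooth) boundary"*
for the `Mᵢ'`: the hull of a compact regular sublevel set `{f ≤ a}` is itself a regular
sublevel set `{F ≤ 0}` of a smooth function `F` which is regular on `{F = 0}`, so that the
tree's regular-sublevel-set machinery (`RegularSublevelSet.lean`, `RegularLevelSplitting.lean`:
half-slice atlases, `Literature.RegularSublevel`) applies to it, and the difference of two hulls
`Mᵢ₊₁' ∖ Int Mᵢ'` is the regular sublevel set `{Fᵢ · Fᵢ₊₁ ≤ 0}` (the trick of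
`RegularSlabCobordism.lean`).

* Local structure at a regular point `x` of the level `{f = f x}` (from the straightening
  chart `exists_halfSliceChart_of_not_isMCriticalPt'`): `x` is in the closure of `{f > f x}`
  (`mem_closure_setOf_lt_of_not_isMCriticalPt`), and `x` has arbitrarily small neighbourhoods
  `U` with `U ∩ {f > f x}` preconnected (`exists_mem_nhds_isPreconnected_inter_setOf_lt`), so
  that near `x` the set `{f > f x}` lies in a single one of its components.
* For a regular value `a` (no critical point on `{f = a}`): the level `{f = a}` is the disjoint
  union of the closed sets of points adjacent to the relatively compact components of `{f > a}`
  and of points adjacent to the other components (inside the proof of the main result;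
  the tool is `closure_subset_of_component_closed`).
* `exists_regular_sublevel_eq_compactHull` — **the hull is a regular sublevel set**: with a
  smooth `θ : M → [0, 1]`, `θ = 0` on the closure of the filled components and `θ = 1` on the
  closure of the free ones (smooth Urysohn, Mathlib's
  `exists_contMDiffMap_zero_one_of_isClosed`) and a constant `C` exceeding `f - a` on the
  hull, the smooth function `F = f - a - C (1 - θ)` satisfies `{F ≤ 0} = compactHull {f ≤ a}`,
  `{F = 0} = {f = a} ∩ closure (free part)`, `interior (compactHull {f ≤ a}) = {F < 0}`,
  `f ≤ F + const`, and `dF = df ≠ 0` on `{F = 0}` (`θ` attains its maximum there, so `dθ = 0`: Fermat, the tree's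
  `isMCriticalPt_of_isLocalMax`).

## References

* A. Phillips, *Submersions of open manifolds*, Topology **6** (1967), proof of Lemma 1.1
  (p. 176). [Phillips1967]
* J. Milnor, *Morse theory* (1963), Thm. 3.1 (regular sublevel sets). [Milnor1963]
-/

open scoped Manifold ContDiff Topology
open Set Function Filter

noncomputable section

universe u

namespace Literature.Topology.FourManifolds

variable {k : ℕ} {M : Type u} [TopologicalSpace M] [T2Space M] [SecondCountableTopology M]
  [ChartedSpace (EuclideanSpace ℝ (Fin (k + 1))) M] [IsManifold (𝓡 (k + 1)) ∞ M]

/-! ### Local structure of a level set at a regular point -/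

omit [T2Space M] [SecondCountableTopology M] in
/-- **A regular point of `f` is in the closure of `{f > f x}`**: in a straightening chart `Θ`
at `x` (`(Θ q) 0 = f x - f q`) the points `Θ⁻¹(Θ x - t e₀)`, `t → 0⁺`, have `f = f x + t` and
tend to `x`. [folklore] -/
theorem mem_closure_setOf_lt_of_not_isMCriticalPt {f : M → ℝ}
    (hf : ContMDiff (𝓡 (k + 1)) 𝓘(ℝ, ℝ) ∞ f) {x : M} (hx : ¬ IsMCriticalPt (𝓡 (k + 1)) f x) :
    x ∈ closure {y | f x < f y} := by
  obtain ⟨D, hxD, hD0⟩ := exists_halfSliceChart_of_not_isMCriticalPt' hf (f x) hx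
  set e₀ : EuclideanSpace ℝ (Fin (k + 1)) := EuclideanSpace.single 0 1 with he₀
  set γ : ℝ → M := fun t => D.Θ.symm (D.Θ x - t • e₀) with hγ
  -- `γ t → x` as `t → 0⁺`
  have hcont : Tendsto (fun t : ℝ => D.Θ x - t • e₀) (𝓝[>] 0) (𝓝 (D.Θ x)) := by
    have : Tendsto (fun t : ℝ => D.Θ x - t • e₀) (𝓝 0) (𝓝 (D.Θ x - (0 : ℝ) • e₀)) :=
      (tendsto_const_nhds.sub (tendsto_id.smul tendsto_const_nhds))
    rw [zero_smul, sub_zero] at this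
    exact this.mono_left nhdsWithin_le_nhds
  have hγt : Tendsto γ (𝓝[>] 0) (𝓝 x) := by
    have h1 : ContinuousAt D.Θ.symm (D.Θ x) := D.Θ.continuousAt_symm (D.Θ.map_source hxD)
    have h2 := h1.tendsto.comp hcont
    rwa [D.Θ.left_inv hxD] at h2
  -- eventually `γ t ∈ {f > f x}`
  have hev : ∀ᶠ t in 𝓝[>] (0 : ℝ), γ t ∈ {y | f x < f y} := by
    have htgt : ∀ᶠ t in 𝓝[>] (0 : ℝ), D.Θ x - t • e₀ ∈ D.Θ.target :=
      hcont (D.Θ.open_target.mem_nhds (D.Θ.map_source hxD))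
    filter_upwards [htgt, self_mem_nhdsWithin] with t ht ht0
    have hsrc : γ t ∈ D.Θ.source := D.Θ.map_target ht
    have h1 : D.Θ (γ t) 0 = f x - f (γ t) := hD0 _ hsrc
    have h2 : D.Θ (γ t) = D.Θ x - t • e₀ := D.Θ.right_inv ht
    have h3 : (D.Θ x - t • e₀) 0 = D.Θ x 0 - t := by simp [he₀]
    have h4 : D.Θ x 0 = f x - f x := hD0 _ hxD
    rw [h2, h3, h4, sub_self, zero_sub] at h1
    show f x < f (γ t)
    have : (0 : ℝ) < t := ht0
    linarith
  exact mem_closure_of_tendsto hγt hev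

omit [T2Space M] [SecondCountableTopology M] in
/-- The same for `{f < f x}` (use the points `Θ⁻¹(Θ x + t e₀)`). [folklore] -/
theorem mem_closure_setOf_gt_of_not_isMCriticalPt {f : M → ℝ}
    (hf : ContMDiff (𝓡 (k + 1)) 𝓘(ℝ, ℝ) ∞ f) {x : M} (hx : ¬ IsMCriticalPt (𝓡 (k + 1)) f x) :
    x ∈ closure {y | f y < f x} := by
  obtain ⟨D, hxD, hD0⟩ := exists_halfSliceChart_of_not_isMCriticalPt' hf (f x) hx
  set e₀ : EuclideanSpace ℝ (Fin (k + 1)) := EuclideanSpace.single 0 1 with he₀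
  set γ : ℝ → M := fun t => D.Θ.symm (D.Θ x + t • e₀) with hγ
  have hcont : Tendsto (fun t : ℝ => D.Θ x + t • e₀) (𝓝[>] 0) (𝓝 (D.Θ x)) := by
    have : Tendsto (fun t : ℝ => D.Θ x + t • e₀) (𝓝 0) (𝓝 (D.Θ x + (0 : ℝ) • e₀)) :=
      (tendsto_const_nhds.add (tendsto_id.smul tendsto_const_nhds))
    rw [zero_smul, add_zero] at this
    exact this.mono_left nhdsWithin_le_nhds
  have hγt : Tendsto γ (𝓝[>] 0) (𝓝 x) := by
    have h1 : ContinuousAt D.Θ.symm (D.Θ x) := D.Θ.continuousAt_symm (D.Θ.map_source hxD)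
    have h2 := h1.tendsto.comp hcont
    rwa [D.Θ.left_inv hxD] at h2
  have hev : ∀ᶠ t in 𝓝[>] (0 : ℝ), γ t ∈ {y | f y < f x} := by
    have htgt : ∀ᶠ t in 𝓝[>] (0 : ℝ), D.Θ x + t • e₀ ∈ D.Θ.target :=
      hcont (D.Θ.open_target.mem_nhds (D.Θ.map_source hxD))
    filter_upwards [htgt, self_mem_nhdsWithin] with t ht ht0
    have hsrc : γ t ∈ D.Θ.source := D.Θ.map_target ht
    have h1 : D.Θ (γ t) 0 = f x - f (γ t) := hD0 _ hsrc
    have h2 : D.Θ (γ t) = D.Θ x + t • e₀ := D.Θ.right_inv ht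
    have h3 : (D.Θ x + t • e₀) 0 = D.Θ x 0 + t := by simp [he₀]
    have h4 : D.Θ x 0 = f x - f x := hD0 _ hxD
    rw [h2, h3, h4, sub_self, zero_add] at h1
    show f (γ t) < f x
    have : (0 : ℝ) < t := ht0
    linarith
  exact mem_closure_of_tendsto hγt hev

omit [T2Space M] [SecondCountableTopology M] in
/-- **Near a regular point, `{f > f x}` has arbitrarily small preconnected traces**: for every
neighbourhood `W` of `x` there is a neighbourhood `U ⊆ W` of `x` such that `U ∩ {f > f x}` is
preconnected — the preimage, under a straightening chart, of the intersection of a ball with an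
open half-space. [folklore] -/
theorem exists_mem_nhds_isPreconnected_inter_setOf_lt {f : M → ℝ}
    (hf : ContMDiff (𝓡 (k + 1)) 𝓘(ℝ, ℝ) ∞ f) {x : M} (hx : ¬ IsMCriticalPt (𝓡 (k + 1)) f x)
    {W : Set M} (hW : W ∈ 𝓝 x) :
    ∃ U ∈ 𝓝 x, U ⊆ W ∧ IsPreconnected (U ∩ {y | f x < f y}) := by
  obtain ⟨D, hxD, hD0⟩ := exists_halfSliceChart_of_not_isMCriticalPt' hf (f x) hx
  -- a ball in the chart, inside the target and inside `Θ.symm ⁻¹' W`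
  have hW' : D.Θ.symm ⁻¹' W ∩ D.Θ.target ∈ 𝓝 (D.Θ x) := by
    refine inter_mem ?_ (D.Θ.open_target.mem_nhds (D.Θ.map_source hxD))
    refine (D.Θ.continuousAt_symm (D.Θ.map_source hxD)).preimage_mem_nhds ?_
    rwa [D.Θ.left_inv hxD]
  obtain ⟨r, hr, hball⟩ := Metric.nhds_basis_ball.mem_iff.1 hW'
  set B : Set (EuclideanSpace ℝ (Fin (k + 1))) := Metric.ball (D.Θ x) r with hB
  have hBt : B ⊆ D.Θ.target := fun z hz => (hball hz).2
  refine ⟨D.Θ.source ∩ D.Θ ⁻¹' B, ?_, ?_, ?_⟩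
  · exact D.Θ.continuousAt (x := x) hxD |>.preimage_mem_nhds
      (Metric.isOpen_ball.mem_nhds (Metric.mem_ball_self hr)) |> inter_mem
        (D.Θ.open_source.mem_nhds hxD)
  · rintro q ⟨hq, hqB⟩
    have := (hball hqB).1
    rwa [mem_preimage, D.Θ.left_inv hq] at this
  · -- `U ∩ {f > f x}` is the image of the convex set `B ∩ {z 0 < 0}` under `Θ.symm`
    have hconv : Convex ℝ (B ∩ {z : EuclideanSpace ℝ (Fin (k + 1)) | z 0 < 0}) := by
      refine (convex_ball _ _).inter ?_
      exact (convex_halfSpace_lt (f := fun z : EuclideanSpace ℝ (Fin (k + 1)) => z 0)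
        ⟨fun a b => rfl, fun c a => rfl⟩ 0)
    have heq : D.Θ.source ∩ D.Θ ⁻¹' B ∩ {y | f x < f y} =
        D.Θ.symm '' (B ∩ {z | z 0 < 0}) := by
      ext q
      constructor
      · rintro ⟨⟨hq, hqB⟩, hfq⟩
        refine ⟨D.Θ q, ⟨hqB, ?_⟩, D.Θ.left_inv hq⟩
        show D.Θ q 0 < 0
        rw [hD0 q hq]
        have : f x < f q := hfq
        linarith
      · rintro ⟨z, ⟨hzB, hz0⟩, rfl⟩
        have hzt : z ∈ D.Θ.target := hBt hzB
        have hsrc : D.Θ.symm z ∈ D.Θ.source := D.Θ.map_target hzt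
        refine ⟨⟨hsrc, ?_⟩, ?_⟩
        · show D.Θ (D.Θ.symm z) ∈ B
          rwa [D.Θ.right_inv hzt]
        · show f x < f (D.Θ.symm z)
          have h1 := hD0 _ hsrc
          rw [D.Θ.right_inv hzt] at h1
          have : z 0 < 0 := hz0
          linarith
    rw [heq]
    exact hconv.isPreconnected.image _ (D.Θ.continuousOn_symm.mono (inter_subset_left.trans hBt))

omit [T2Space M] [SecondCountableTopology M] in
/-- The same with the closed half-space: for every neighbourhood `W` of a regular point `x`
there is a neighbourhood `U ⊆ W` of `x` with `U ∩ {f ≥ f x}` preconnected (and containing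
`x`). [folklore] -/
theorem exists_mem_nhds_isPreconnected_inter_setOf_le {f : M → ℝ}
    (hf : ContMDiff (𝓡 (k + 1)) 𝓘(ℝ, ℝ) ∞ f) {x : M} (hx : ¬ IsMCriticalPt (𝓡 (k + 1)) f x)
    {W : Set M} (hW : W ∈ 𝓝 x) :
    ∃ U ∈ 𝓝 x, U ⊆ W ∧ IsPreconnected (U ∩ {y | f x ≤ f y}) := by
  obtain ⟨D, hxD, hD0⟩ := exists_halfSliceChart_of_not_isMCriticalPt' hf (f x) hx
  have hW' : D.Θ.symm ⁻¹' W ∩ D.Θ.target ∈ 𝓝 (D.Θ x) := by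
    refine inter_mem ?_ (D.Θ.open_target.mem_nhds (D.Θ.map_source hxD))
    refine (D.Θ.continuousAt_symm (D.Θ.map_source hxD)).preimage_mem_nhds ?_
    rwa [D.Θ.left_inv hxD]
  obtain ⟨r, hr, hball⟩ := Metric.nhds_basis_ball.mem_iff.1 hW'
  set B : Set (EuclideanSpace ℝ (Fin (k + 1))) := Metric.ball (D.Θ x) r with hB
  have hBt : B ⊆ D.Θ.target := fun z hz => (hball hz).2
  refine ⟨D.Θ.source ∩ D.Θ ⁻¹' B, ?_, ?_, ?_⟩
  · exact D.Θ.continuousAt (x := x) hxD |>.preimage_mem_nhds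
      (Metric.isOpen_ball.mem_nhds (Metric.mem_ball_self hr)) |> inter_mem
        (D.Θ.open_source.mem_nhds hxD)
  · rintro q ⟨hq, hqB⟩
    have := (hball hqB).1
    rwa [mem_preimage, D.Θ.left_inv hq] at this
  · have hconv : Convex ℝ (B ∩ {z : EuclideanSpace ℝ (Fin (k + 1)) | z 0 ≤ 0}) := by
      refine (convex_ball _ _).inter ?_
      exact (convex_halfSpace_le (f := fun z : EuclideanSpace ℝ (Fin (k + 1)) => z 0)
        ⟨fun a b => rfl, fun c a => rfl⟩ 0)
    have heq : D.Θ.source ∩ D.Θ ⁻¹' B ∩ {y | f x ≤ f y} =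
        D.Θ.symm '' (B ∩ {z | z 0 ≤ 0}) := by
      ext q
      constructor
      · rintro ⟨⟨hq, hqB⟩, hfq⟩
        refine ⟨D.Θ q, ⟨hqB, ?_⟩, D.Θ.left_inv hq⟩
        show D.Θ q 0 ≤ 0
        rw [hD0 q hq]
        have : f x ≤ f q := hfq
        linarith
      · rintro ⟨z, ⟨hzB, hz0⟩, rfl⟩
        have hzt : z ∈ D.Θ.target := hBt hzB
        have hsrc : D.Θ.symm z ∈ D.Θ.source := D.Θ.map_target hzt
        refine ⟨⟨hsrc, ?_⟩, ?_⟩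
        · show D.Θ (D.Θ.symm z) ∈ B
          rwa [D.Θ.right_inv hzt]
        · show f x ≤ f (D.Θ.symm z)
          have h1 := hD0 _ hsrc
          rw [D.Θ.right_inv hzt] at h1
          have : z 0 ≤ 0 := hz0
          linarith
    rw [heq]
    exact hconv.isPreconnected.image _ (D.Θ.continuousOn_symm.mono (inter_subset_left.trans hBt))

omit [T2Space M] [SecondCountableTopology M] in
/-- **Near a regular point of the level `{f = a}`, the set `{f > a}` lies in one of its
components**, and `x` is adherent to that component. [folklore] -/
theorem exists_mem_nhds_subset_connectedComponentIn {f : M → ℝ}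
    (hf : ContMDiff (𝓡 (k + 1)) 𝓘(ℝ, ℝ) ∞ f) {a : ℝ} {x : M} (hxa : f x = a)
    (hx : ¬ IsMCriticalPt (𝓡 (k + 1)) f x) :
    ∃ U ∈ 𝓝 x, ∃ y₀, a < f y₀ ∧
      U ∩ {y | a < f y} ⊆ connectedComponentIn {y | a < f y} y₀ := by
  subst hxa
  obtain ⟨U, hU, -, hpre⟩ := exists_mem_nhds_isPreconnected_inter_setOf_lt hf hx univ_mem
  have hne : (U ∩ {y | f x < f y}).Nonempty := by
    have hcl := mem_closure_setOf_lt_of_not_isMCriticalPt hf hx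
    rw [mem_closure_iff_nhds] at hcl
    exact hcl U hU
  obtain ⟨y₀, hy₀U, hy₀⟩ := hne
  exact ⟨U, hU, y₀, hy₀, hpre.subset_connectedComponentIn ⟨hy₀U, hy₀⟩ inter_subset_right⟩

/-! ### The filled and the free part of `{f > a}` and their closures -/

section Parts

variable {f : M → ℝ} {a : ℝ}

/-- The complement of the sublevel set `{f ≤ a}` is `{f > a}`. [folklore] -/
theorem compl_preimage_Iic_eq {α : Type*} (f : α → ℝ) (a : ℝ) :
    (f ⁻¹' Iic a)ᶜ = {y | a < f y} := by
  ext y; simp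

omit [T2Space M] [SecondCountableTopology M] [IsManifold (𝓡 (k + 1)) ∞ M]
  [ChartedSpace (EuclideanSpace ℝ (Fin (k + 1))) M] in
/-- **The closure of a union of components of the open set `{f > a}` adds only points of the
level `{f = a}`**: a point of `{f > a}` adherent to a family of components of `{f > a}` closed
under passing to the component (membership depends only on the component) belongs to the
family. [folklore] -/
theorem closure_subset_of_component_closed (hf : Continuous f) {P : M → Prop}
    (hP : ∀ {y z}, z ∈ connectedComponentIn {y | a < f y} y → (P y ↔ P z))
    [LocallyConnectedSpace M] :
    closure {y | a < f y ∧ P y} ⊆ {y | a < f y ∧ P y} ∪ f ⁻¹' {a} := by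
  intro y hy
  have hopen : IsOpen {y : M | a < f y} := isOpen_lt continuous_const hf
  rcases lt_trichotomy (f y) a with hlt | heq | hgt
  · exfalso
    have : {z : M | f z < a} ∈ 𝓝 y := (isOpen_lt hf continuous_const).mem_nhds hlt
    obtain ⟨z, hzt, hzs⟩ := mem_closure_iff_nhds.1 hy _ this
    exact absurd hzs.1 (not_lt.2 (le_of_lt hzt))
  · exact Or.inr heq
  · left
    refine ⟨hgt, ?_⟩
    have hC : connectedComponentIn {y | a < f y} y ∈ 𝓝 y :=
      (hopen.connectedComponentIn).mem_nhds (mem_connectedComponentIn hgt)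
    obtain ⟨z, hzC, hzs⟩ := mem_closure_iff_nhds.1 hy _ hC
    exact (hP hzC).2 hzs.2

end Parts

/-! ### The hull of a regular sublevel set is a regular sublevel set -/

/-- **The compact hull of a regular sublevel set is a regular sublevel set** (the manifolds
`Mᵢ'` of Phillips' Lemma 1.1). Let `M` be a `C^∞` manifold without boundary modelled on
`ℝᵏ⁺¹` (Hausdorff, second countable) with no compact component, `f : M → ℝ` smooth, and `a` a
value such that `{f ≤ a}` is compact and no point of the level `{f = a}` is critical. Then
there is a smooth `F : M → ℝ` with `{F ≤ 0} = compactHull {f ≤ a}` — the sublevel set together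
with the relatively compact components of `{f > a}` —, whose zero set `{F = 0}` lies in the
level `{f = a}` and carries no critical point of `F`, and with
`interior (compactHull {f ≤ a}) = {F < 0}`; moreover `compactHull {f ≤ a}` is compact, and
`f ≤ F + C` for a constant `C` (so `F` is proper as soon as `f` is). Construction: `F = f - a - C (1 - θ)` for a constant `C > sup (f - a)` over the (compact) hull
and a smooth `θ : M → [0, 1]` vanishing on the closure of the filled components and equal to
`1` on the closure of the free ones (these closed sets are disjoint because near a regular
point of the level all of `{f > a}` lies in one component).
[cite: Phillips1967, proof of Lemma 1.1 (p. 176)] -/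
theorem exists_regular_sublevel_eq_compactHull
    (hopen : ∀ x : M, ¬ IsCompact (connectedComponent x)) {f : M → ℝ}
    (hf : ContMDiff (𝓡 (k + 1)) 𝓘(ℝ, ℝ) ∞ f) {a : ℝ} (hcpt : IsCompact (f ⁻¹' Iic a))
    (hreg : ∀ x, f x = a → ¬ IsMCriticalPt (𝓡 (k + 1)) f x) :
    ∃ F : M → ℝ, ContMDiff (𝓡 (k + 1)) 𝓘(ℝ, ℝ) ∞ F ∧
      F ⁻¹' Iic 0 = Literature.Topology.compactHull (f ⁻¹' Iic a) ∧
      (∀ x, F x = 0 → f x = a ∧ ¬ IsMCriticalPt (𝓡 (k + 1)) F x) ∧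
      interior (Literature.Topology.compactHull (f ⁻¹' Iic a)) = F ⁻¹' Iio 0 ∧
      IsCompact (Literature.Topology.compactHull (f ⁻¹' Iic a)) ∧
      ∃ C : ℝ, ∀ y, f y ≤ F y + C := by
  classical
  haveI : LocallyConnectedSpace M :=
    ChartedSpace.locallyConnectedSpace (EuclideanSpace ℝ (Fin (k + 1))) M
  haveI : LocallyCompactSpace M :=
    ChartedSpace.locallyCompactSpace (EuclideanSpace ℝ (Fin (k + 1))) M
  haveI : SigmaCompactSpace M := sigmaCompactSpace_of_locallyCompact_secondCountable
  set K : Set M := f ⁻¹' Iic a with hK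
  set H : Set M := Literature.Topology.compactHull K with hH
  have hKc : (Kᶜ) = {y | a < f y} := compl_preimage_Iic_eq f a
  -- the filled and the free part of `{f > a}`
  set Pfill : M → Prop := fun y => IsCompact (closure (connectedComponentIn {y | a < f y} y))
    with hPfill
  have hPcomp : ∀ {y z : M}, z ∈ connectedComponentIn {y | a < f y} y → (Pfill y ↔ Pfill z) := by
    intro y z hz
    simp only [hPfill, connectedComponentIn_eq hz]
  set Bfill : Set M := {y | a < f y ∧ Pfill y} with hBfill
  set Bfree : Set M := {y | a < f y ∧ ¬ Pfill y} with hBfree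
  have hHmem : ∀ y, y ∈ H ↔ f y ≤ a ∨ (a < f y ∧ Pfill y) := by
    intro y
    rw [hH, Literature.Topology.mem_compactHull_iff, hKc]
    simp only [hK, mem_preimage, mem_Iic, not_le, hPfill]
  have hHc : Hᶜ = Bfree := by
    ext y
    simp only [mem_compl_iff, hHmem, not_or, not_and, not_le, hBfree, mem_setOf_eq]
    constructor
    · rintro ⟨h1, h2⟩; exact ⟨h1, h2 h1⟩
    · rintro ⟨h1, h2⟩; exact ⟨h1, fun _ => h2⟩
  have hBfillH : Bfill ⊆ H := fun y hy => (hHmem y).2 (Or.inr hy)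
  -- closures
  have hclfill : closure Bfill ⊆ Bfill ∪ f ⁻¹' {a} :=
    closure_subset_of_component_closed hf.continuous (P := Pfill) hPcomp
  have hclfree : closure Bfree ⊆ Bfree ∪ f ⁻¹' {a} :=
    closure_subset_of_component_closed hf.continuous (P := fun y => ¬ Pfill y)
      (fun hz => not_congr (hPcomp hz))
  -- the two closures are disjoint
  have hdisj : Disjoint (closure Bfill) (closure Bfree) := by
    rw [disjoint_iff_inter_eq_empty, eq_empty_iff_forall_notMem]
    rintro y ⟨hy1, hy2⟩
    have hya : f y = a := by
      rcases hclfill hy1 with h | h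
      · rcases hclfree hy2 with h' | h'
        · exact absurd h.2 h'.2
        · exact h'
      · exact h
    obtain ⟨U, hU, y₀, hy₀, hUsub⟩ :=
      exists_mem_nhds_subset_connectedComponentIn hf hya (hreg y hya)
    obtain ⟨z, hzU, hzB⟩ := mem_closure_iff_nhds.1 hy1 U hU
    obtain ⟨z', hz'U, hz'B⟩ := mem_closure_iff_nhds.1 hy2 U hU
    have hz : z ∈ connectedComponentIn {y | a < f y} y₀ := hUsub ⟨hzU, hzB.1⟩
    have hz' : z' ∈ connectedComponentIn {y | a < f y} y₀ := hUsub ⟨hz'U, hz'B.1⟩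
    exact hz'B.2 ((hPcomp hz').1 ((hPcomp hz).2 hzB.2))
  -- compactness of the hull and a bound for `f - a` on it
  have hHcpt : IsCompact H := Literature.Topology.isCompact_compactHull hopen hcpt
  obtain ⟨C₀, hC₀⟩ := hHcpt.exists_bound_of_continuousOn hf.continuous.continuousOn
  set C : ℝ := |C₀| + |a| + 1 with hC
  have hCpos : 0 < C := by simp only [hC]; positivity
  have hfC : ∀ y ∈ H, f y - a < C := by
    intro y hy
    have h1 : ‖f y‖ ≤ C₀ := hC₀ y hy
    rw [Real.norm_eq_abs] at h1
    have h2 : f y ≤ |C₀| := (le_abs_self _).trans (h1.trans (le_abs_self _))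
    have h3 : -a ≤ |a| := neg_le_abs a
    simp only [hC]
    linarith
  -- the smooth Urysohn function and `F = f - a - C (1 - θ)`
  obtain ⟨θ, hθ0, hθ1, hθ01⟩ := exists_contMDiffMap_zero_one_of_isClosed (𝓡 (k + 1)) (n := ⊤)
    isClosed_closure isClosed_closure hdisj
  set F : M → ℝ := fun y => f y - a - C + C * θ y with hF
  have hθs : ContMDiff (𝓡 (k + 1)) 𝓘(ℝ, ℝ) ∞ θ := θ.contMDiff
  have hFs : ContMDiff (𝓡 (k + 1)) 𝓘(ℝ, ℝ) ∞ F :=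
    ((hf.sub contMDiff_const).sub contMDiff_const).add (contMDiff_const.mul hθs)
  -- values of `F`
  have hclfillH : closure Bfill ⊆ H :=
    (closure_mono hBfillH).trans (Literature.Topology.isClosed_compactHull
      (hK ▸ (isClosed_Iic.preimage hf.continuous))).closure_subset
  have hF_fill : ∀ y ∈ closure Bfill, F y < 0 := fun y hy => by
    have h : θ y = 0 := hθ0 hy
    have h' := hfC y (hclfillH hy)
    show f y - a - C + C * θ y < 0
    rw [h, mul_zero, add_zero]
    linarith
  have hF_free : ∀ y ∈ closure Bfree, F y = f y - a := fun y hy => by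
    have h : θ y = 1 := hθ1 hy
    show f y - a - C + C * θ y = f y - a
    rw [h]; ring
  have hF_lt : ∀ y, f y < a → F y < 0 := fun y hy => by
    have h1 : θ y ≤ 1 := (hθ01 y).2
    show f y - a - C + C * θ y < 0
    nlinarith
  -- the level splits
  have hlevel : ∀ y, f y = a → y ∈ closure Bfill ∨ y ∈ closure Bfree := by
    intro y hya
    have hcl : y ∈ closure {z | f y < f z} :=
      mem_closure_setOf_lt_of_not_isMCriticalPt hf (hreg y hya)
    have heq : {z | f y < f z} = Bfill ∪ Bfree := by
      ext z
      simp only [hBfill, hBfree, mem_setOf_eq, mem_union, hya]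
      tauto
    rw [heq, closure_union] at hcl
    exact hcl
  -- (1) the sublevel set of `F` is the hull
  have hsub : F ⁻¹' Iic 0 = H := by
    ext y
    simp only [mem_preimage, mem_Iic, hHmem]
    rcases lt_trichotomy (f y) a with hlt | heq | hgt
    · exact ⟨fun _ => Or.inl hlt.le, fun _ => (hF_lt y hlt).le⟩
    · refine ⟨fun _ => Or.inl heq.le, fun _ => ?_⟩
      rcases hlevel y heq with h | h
      · exact (hF_fill y h).le
      · rw [hF_free y h, heq, sub_self]
    · by_cases hP : Pfill y
      · have hyB : y ∈ Bfill := ⟨hgt, hP⟩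
        exact ⟨fun _ => Or.inr ⟨hgt, hP⟩, fun _ => (hF_fill y (subset_closure hyB)).le⟩
      · have hyB : y ∈ Bfree := ⟨hgt, hP⟩
        constructor
        · intro hFy
          rw [hF_free y (subset_closure hyB)] at hFy
          exact absurd hgt (not_lt.2 (by linarith))
        · rintro (h | ⟨-, h⟩)
          · exact absurd hgt (not_lt.2 h)
          · exact absurd h hP
  -- (2) the zero set: in the level, adjacent to the free part, regular
  have hzero : ∀ y, F y = 0 → f y = a ∧ y ∈ closure Bfree := by
    intro y hFy
    rcases lt_trichotomy (f y) a with hlt | heq | hgt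
    · exact absurd hFy (hF_lt y hlt).ne
    · refine ⟨heq, ?_⟩
      rcases hlevel y heq with h | h
      · exact absurd hFy (hF_fill y h).ne
      · exact h
    · exfalso
      by_cases hP : Pfill y
      · exact absurd hFy (hF_fill y (subset_closure ⟨hgt, hP⟩)).ne
      · rw [hF_free y (subset_closure ⟨hgt, hP⟩)] at hFy
        exact absurd hgt (not_lt.2 (by linarith))
  have hregF : ∀ y, F y = 0 → ¬ IsMCriticalPt (𝓡 (k + 1)) F y := by
    intro y hFy hcrit
    obtain ⟨hya, hyfree⟩ := hzero y hFy
    have hθy : θ y = 1 := hθ1 hyfree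
    -- `θ` has a maximum at `y`, so `dθ_y = 0`
    have hθcrit : IsMCriticalPt (𝓡 (k + 1)) θ y :=
      isMCriticalPt_of_isLocalMax (Filter.Eventually.of_forall fun z => by
        rw [hθy]; exact (hθ01 z).2) (isInteriorPoint_euclidean y)
    have hdθ : HasMFDerivAt (𝓡 (k + 1)) 𝓘(ℝ, ℝ) θ y
        (0 : TangentSpace (𝓡 (k + 1)) y →L[ℝ] ℝ) := by
      have := (hθs.mdifferentiableAt (x := y) (by simp)).hasMFDerivAt
      rwa [show mfderiv (𝓡 (k + 1)) 𝓘(ℝ, ℝ) θ y = 0 from hθcrit] at this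
    have hdf : HasMFDerivAt (𝓡 (k + 1)) 𝓘(ℝ, ℝ) f y (mfderiv (𝓡 (k + 1)) 𝓘(ℝ, ℝ) f y) :=
      (hf.mdifferentiableAt (by simp)).hasMFDerivAt
    -- `F = G + const` with `G = f + C θ`, `dG_y = df_y + C • 0 = df_y`
    have hG := hdf.add (hdθ.const_smul C)
    have hcritG : IsMCriticalPt (𝓡 (k + 1)) (f + C • (θ : M → ℝ)) y := by
      refine (isMCriticalPt_congr_of_eventuallyEq_add_const (f := f + C • (θ : M → ℝ))
        (g := F) (c := -a - C) (Filter.Eventually.of_forall fun z => ?_)).1 hcrit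
      show f z - a - C + C * θ z = f z + C * θ z + (-a - C)
      ring
    have h0 : mfderiv (𝓡 (k + 1)) 𝓘(ℝ, ℝ) f y = 0 := by
      have h1 := hG.mfderiv
      unfold IsMCriticalPt at hcritG
      rw [hcritG] at h1
      simp only [smul_zero, add_zero] at h1
      exact h1.symm
    exact hreg y hya h0
  -- (3) the interior of the hull
  have hint : interior H = F ⁻¹' Iio 0 := by
    apply Subset.antisymm
    · intro y hy
      have hyH : y ∈ H := interior_subset hy
      rw [← hsub] at hyH
      rcases (show F y ≤ 0 from hyH).lt_or_eq with h | h
      · exact h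
      · exfalso
        -- `y` is in the level and adjacent to the free part, which misses `H`
        obtain ⟨-, hyfree⟩ := hzero y h
        have : y ∈ closure (Hᶜ) := by rw [hHc]; exact hyfree
        rw [closure_compl] at this
        exact this hy
    · rw [← hsub]
      exact interior_maximal (fun y (hy : F y < 0) => (hy.le : F y ≤ 0))
        (isOpen_lt hFs.continuous continuous_const)
  -- (4) `f ≤ F + (a + C)` (as `0 ≤ θ`), so that `F` is proper when `f` is
  have hbound : ∀ y, f y ≤ F y + (a + C) := fun y => by
    have h0 : 0 ≤ θ y := (hθ01 y).1
    show f y ≤ f y - a - C + C * θ y + (a + C)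
    nlinarith
  exact ⟨F, hFs, hsub, fun y hy => ⟨(hzero y hy).1, hregF y hy⟩, hint, hHcpt, a + C, hbound⟩

end Literature.Topology.FourManifolds
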